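import Summits.QuantumAdvantage.AdviceFreeQNC0.SymmetricCodewords
import Summits.QuantumAdvantage.AdviceFreeQNC0.MassInequalityK
import HarnessLib

/-!
# Cell qa-qnc0 (rung F-Q1, density axis): `w(8,1) = 45`, `w(9,1) = 90`, `w(15,1) = 8736` — OPTIMALITY OF THE SYMMETRIC
# WORD AMONG ALL CODEWORDS (kernel), and the existence conjunct of `MIChainFifteen`

By the orbit-counting engine (`SymmetricCount.lean`, `SymmetricCodewords.lean`): every codeword of `C_m` has
`failCount = G4 p q r s (…)` for its block sizes, so `IsOpt1 m (symWord m b)` is the finite check `OptCheck m w`, decided by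
the kernel slice by slice (`optSliceB m w p`, `decide +kernel`, a few seconds per `m`); `symWord m b` = the symmetric
codeword `(1, b ⊕ parity, ¬(b ⊕ parity))`.

* `isOpt1_symWord_eight` (`symWord 8 true`, `failCount = 45`), `isOpt1_symWord_nine` (`symWord 9 true`, `90`),
  **`isOpt1_symWord_fifteen` (`symWord 15 false`, `8736`)** — the planner's `w(m,1)` values (ROUND-12 (xi-n): 45, 90, 8736 by
  kit13/w1_orbit.py) are now theorems: a symmetric word has the fewest zeros among ALL `2^{2m+2}` codewords;
* **`exists_opt_sym_fifteen : ∃ K0, IsOpt1 15 K0 ∧ IsSymPat K0 ∧ 2^15 < 4·failCount K0`** — the existence conjunct of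
  `MassInequality.MIChainFifteen` (8736·4 = 34944 > 32768), hence
  **`tensorMultOneAt_of_massIneq_fifteen : MassIneqAll 15 → MassIneqKPays 15 → TensorMultOneAt`** — with qn-prover's
  `massIneqKPays` the density axis is reduced to the single conjecture `MassIneqAll 15` in the kernel.

WHAT THIS IS NOT: `MassIneqAll 15` (MI) is OPEN; nothing on crux α; separation NOT moved.
-/

namespace Summit.QuantumAdvantage.AdviceFreeQNC0

open Finset

namespace SymCount

open Summit.QuantumAdvantage.AdviceFreeQNC0.MassInequality

/-! ### m = 8: `w(8,1) = 45` -/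

/-- Slice `p = 0` of `OptCheck 8 45`. -/
theorem optSlice8_0 : optSliceB 8 45 0 = true := by decide +kernel
/-- Slice `p = 1` of `OptCheck 8 45`. -/
theorem optSlice8_1 : optSliceB 8 45 1 = true := by decide +kernel
/-- Slice `p = 2` of `OptCheck 8 45`. -/
theorem optSlice8_2 : optSliceB 8 45 2 = true := by decide +kernel
/-- Slice `p = 3` of `OptCheck 8 45`. -/
theorem optSlice8_3 : optSliceB 8 45 3 = true := by decide +kernel
/-- Slice `p = 4` of `OptCheck 8 45`. -/
theorem optSlice8_4 : optSliceB 8 45 4 = true := by decide +kernel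
/-- Slice `p = 5` of `OptCheck 8 45`. -/
theorem optSlice8_5 : optSliceB 8 45 5 = true := by decide +kernel
/-- Slice `p = 6` of `OptCheck 8 45`. -/
theorem optSlice8_6 : optSliceB 8 45 6 = true := by decide +kernel
/-- Slice `p = 7` of `OptCheck 8 45`. -/
theorem optSlice8_7 : optSliceB 8 45 7 = true := by decide +kernel
/-- Slice `p = 8` of `OptCheck 8 45`. -/
theorem optSlice8_8 : optSliceB 8 45 8 = true := by decide +kernel

/-- The finite check at `m = 8`. -/
theorem optCheck8 : OptCheck 8 45 := by
  refine optCheck_of_slices fun p hp => ?_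
  interval_cases p
  · exact optSlice8_0
  · exact optSlice8_1
  · exact optSlice8_2
  · exact optSlice8_3
  · exact optSlice8_4
  · exact optSlice8_5
  · exact optSlice8_6
  · exact optSlice8_7
  · exact optSlice8_8

/-- `failCount (symWord 8 true) = 45`. -/
theorem failCount_symWord_eight : failCount (symWord 8 true) = 45 := by
  rw [failCount_symWord, ← G4r_eq]; decide +kernel

/-- **`w(8,1) = 45`: the symmetric word is optimal among ALL codewords of `C_8`.** -/
theorem isOpt1_symWord_eight : IsOpt1 8 (symWord 8 true) :=
  isOpt1_of_optCheck optCheck8 (isElim1_symWord 8 true) failCount_symWord_eight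

/-! ### m = 9: `w(9,1) = 90` -/

/-- Slice `p = 0` of `OptCheck 9 90`. -/
theorem optSlice9_0 : optSliceB 9 90 0 = true := by decide +kernel
/-- Slice `p = 1` of `OptCheck 9 90`. -/
theorem optSlice9_1 : optSliceB 9 90 1 = true := by decide +kernel
/-- Slice `p = 2` of `OptCheck 9 90`. -/
theorem optSlice9_2 : optSliceB 9 90 2 = true := by decide +kernel
/-- Slice `p = 3` of `OptCheck 9 90`. -/
theorem optSlice9_3 : optSliceB 9 90 3 = true := by decide +kernel
/-- Slice `p = 4` of `OptCheck 9 90`. -/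
theorem optSlice9_4 : optSliceB 9 90 4 = true := by decide +kernel
/-- Slice `p = 5` of `OptCheck 9 90`. -/
theorem optSlice9_5 : optSliceB 9 90 5 = true := by decide +kernel
/-- Slice `p = 6` of `OptCheck 9 90`. -/
theorem optSlice9_6 : optSliceB 9 90 6 = true := by decide +kernel
/-- Slice `p = 7` of `OptCheck 9 90`. -/
theorem optSlice9_7 : optSliceB 9 90 7 = true := by decide +kernel
/-- Slice `p = 8` of `OptCheck 9 90`. -/
theorem optSlice9_8 : optSliceB 9 90 8 = true := by decide +kernel
/-- Slice `p = 9` of `OptCheck 9 90`. -/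
theorem optSlice9_9 : optSliceB 9 90 9 = true := by decide +kernel

/-- The finite check at `m = 9`. -/
theorem optCheck9 : OptCheck 9 90 := by
  refine optCheck_of_slices fun p hp => ?_
  interval_cases p
  · exact optSlice9_0
  · exact optSlice9_1
  · exact optSlice9_2
  · exact optSlice9_3
  · exact optSlice9_4
  · exact optSlice9_5
  · exact optSlice9_6
  · exact optSlice9_7
  · exact optSlice9_8
  · exact optSlice9_9

/-- `failCount (symWord 9 true) = 90`. -/
theorem failCount_symWord_nine : failCount (symWord 9 true) = 90 := by
  rw [failCount_symWord, ← G4r_eq]; decide +kernel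

/-- **`w(9,1) = 90`: the symmetric word is optimal among ALL codewords of `C_9`.** -/
theorem isOpt1_symWord_nine : IsOpt1 9 (symWord 9 true) :=
  isOpt1_of_optCheck optCheck9 (isElim1_symWord 9 true) failCount_symWord_nine

/-! ### m = 15: `w(15,1) = 8736` -/

/-- Slice `p = 0` of `OptCheck 15 8736`. -/
theorem optSlice15_0 : optSliceB 15 8736 0 = true := by decide +kernel
/-- Slice `p = 1` of `OptCheck 15 8736`. -/
theorem optSlice15_1 : optSliceB 15 8736 1 = true := by decide +kernel
/-- Slice `p = 2` of `OptCheck 15 8736`. -/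
theorem optSlice15_2 : optSliceB 15 8736 2 = true := by decide +kernel
/-- Slice `p = 3` of `OptCheck 15 8736`. -/
theorem optSlice15_3 : optSliceB 15 8736 3 = true := by decide +kernel
/-- Slice `p = 4` of `OptCheck 15 8736`. -/
theorem optSlice15_4 : optSliceB 15 8736 4 = true := by decide +kernel
/-- Slice `p = 5` of `OptCheck 15 8736`. -/
theorem optSlice15_5 : optSliceB 15 8736 5 = true := by decide +kernel
/-- Slice `p = 6` of `OptCheck 15 8736`. -/
theorem optSlice15_6 : optSliceB 15 8736 6 = true := by decide +kernel
/-- Slice `p = 7` of `OptCheck 15 8736`. -/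
theorem optSlice15_7 : optSliceB 15 8736 7 = true := by decide +kernel
/-- Slice `p = 8` of `OptCheck 15 8736`. -/
theorem optSlice15_8 : optSliceB 15 8736 8 = true := by decide +kernel
/-- Slice `p = 9` of `OptCheck 15 8736`. -/
theorem optSlice15_9 : optSliceB 15 8736 9 = true := by decide +kernel
/-- Slice `p = 10` of `OptCheck 15 8736`. -/
theorem optSlice15_10 : optSliceB 15 8736 10 = true := by decide +kernel
/-- Slice `p = 11` of `OptCheck 15 8736`. -/
theorem optSlice15_11 : optSliceB 15 8736 11 = true := by decide +kernel
/-- Slice `p = 12` of `OptCheck 15 8736`. -/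
theorem optSlice15_12 : optSliceB 15 8736 12 = true := by decide +kernel
/-- Slice `p = 13` of `OptCheck 15 8736`. -/
theorem optSlice15_13 : optSliceB 15 8736 13 = true := by decide +kernel
/-- Slice `p = 14` of `OptCheck 15 8736`. -/
theorem optSlice15_14 : optSliceB 15 8736 14 = true := by decide +kernel
/-- Slice `p = 15` of `OptCheck 15 8736`. -/
theorem optSlice15_15 : optSliceB 15 8736 15 = true := by decide +kernel

/-- The finite check at `m = 15`. -/
theorem optCheck15 : OptCheck 15 8736 := by
  refine optCheck_of_slices fun p hp => ?_
  interval_cases p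
  · exact optSlice15_0
  · exact optSlice15_1
  · exact optSlice15_2
  · exact optSlice15_3
  · exact optSlice15_4
  · exact optSlice15_5
  · exact optSlice15_6
  · exact optSlice15_7
  · exact optSlice15_8
  · exact optSlice15_9
  · exact optSlice15_10
  · exact optSlice15_11
  · exact optSlice15_12
  · exact optSlice15_13
  · exact optSlice15_14
  · exact optSlice15_15

/-- `failCount (symWord 15 false) = 8736`. -/
theorem failCount_symWord_fifteen : failCount (symWord 15 false) = 8736 := by
  rw [failCount_symWord, ← G4r_eq]; decide +kernel

/-- **`w(15,1) = 8736`: the symmetric word is optimal among ALL codewords of `C_15`.** -/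
theorem isOpt1_symWord_fifteen : IsOpt1 15 (symWord 15 false) :=
  isOpt1_of_optCheck optCheck15 (isElim1_symWord 15 false) failCount_symWord_fifteen

/-! ### The existence conjunct of `MIChainFifteen` and the reduced chain -/

/-- **The existence conjunct of `MIChainFifteen`**: an optimal symmetric codeword at `m = 15` with
`4 · failCount > 2^15` (`8736 · 4 = 34944 > 32768`). -/
theorem exists_opt_sym_fifteen :
    ∃ K0 : (Fin 15 → Bool) → Bool, IsOpt1 15 K0 ∧ IsSymPat K0 ∧ 2 ^ 15 < 4 * failCount K0 :=
  ⟨symWord 15 false, isOpt1_symWord_fifteen, isSymPat_symWord 15 false,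
    by rw [failCount_symWord_fifteen]; norm_num⟩

/-- **The density axis reduced to MI at m = 15**: `MassIneqAll 15 → MassIneqKPays 15 → TensorMultOneAt`
(`MassIneqKPays 15` is qn-prover's recursion; `MassIneqAll 15` is the conjecture of record). -/
theorem tensorMultOneAt_of_massIneq_fifteen (hall : MassIneqAll 15) (hpays : MassIneqKPays 15) :
    TensorMultOneAt := by
  have hopt := isOpt1_symWord_fifteen
  have hmi : ∀ k, 0 < k → MassIneqK 15 k (symWord 15 false) := fun k hk =>
    hall _ hopt (isSymPat_symWord 15 false) k hk
  have ht := hpays _ hopt hmi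
  refine ⟨15, (failCount (symWord 15 false) : ℝ) / (2 : ℝ) ^ 15, ?_, ht⟩
  rw [failCount_symWord_fifteen]
  norm_num

end SymCount

end Summit.QuantumAdvantage.AdviceFreeQNC0
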